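import Summits.CriticalPhenomena.PercolationContinuityZ3.Theorems.PercNearOneGluingNoHeavyLowerTailSunflowerChainCertificateLocal
import Mathlib.Data.Fin.Tuple.Sort
import HarnessLib
import HarnessLib.Audit

/-!
# `NoHeavyLowerTail` (crux stmt-CriticalPhenomena-4575), chain certificates — FINITE VERIFICATION I: sorted triples, positions,
# depth-first enumeration with completeness, per-pattern tables, slot records, admissible choices

Support file (seat `prim-ineq-prove-1` gen 33; `--supports stmt-CriticalPhenomena-4575`); part of the kernel replay of
`ChainCert.ThreeBlockMedianCertificate` (files …ChainCertificate ⟵ …Structure ⟵ …Duality ⟵ …Local ⟵ …Enumeration ⟵ …Checker ⟵ …Reps ⟵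
…Sound ⟵ …Final ⟵ compiled-check files ⟵ …Holds).  No `sorry`, no named facts, nothing asserted about the crux.  The whole chain elaborates as
ONE file (HOME/code-g33/lean/File6dev.lean, rc 0); these tree files are consecutive verbatim slices of it.  Memo:
run/shared/lean/prim/prim-ineq-prove-1/FINDING-CHAINCERT-prove1-g33.md §4–§7.

CONTENTS.  (A) `orbitSum_act`, `exists_sorted` (`Tuple.sort`), `patPre`/`tieBits`, `preOf_eq_patPre`, `threeBlockMedianCertificate_of_patterns`
(WLOG the triple is sorted in every block: 64 tie patterns).  (B) `dec/enc`.  (C) `enumSeq`/`mem_enumSeq` (all admissible lists; complete) and the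
depth-first `allSeq`/`allSeq_spec`.  (D) `decN/encN`, `leJ/eqvJ`, `permList/mkSlot/slotSum`, `sum_sym3_eq_slotSum` (`Σ_{g ∈ S₃³}` = explicit 216-term
list sum), tables `leTab/canonTab/medTab`, slot records `SlotRec/mkRec/slotTriples/slotRecs` (positions of slots and lifts computed once), `slotSum_eq`,
admissible-choice functions `choicesCell` (monotone cells, from the comparison-position tables `cmpTabs`) and `compPet`/`choicesRep` (canonical class
representatives of petal positions).
-/

namespace Summit.CriticalPhenomena.PercolationContinuityZ3.Theorems.SunflowerPartition

namespace ChainCert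

open Finset

section FiniteCheck

variable {n : Fin 3 → ℕ}

/-! ### A. Without loss of generality the triple is sorted in every block -/

/-- Orbit sums are constant on orbits. [this work] -/
theorem orbitSum_act {k : ℕ} {n : Fin k → ℕ} (κ : (Fin 3 → Pt n) → ℤ) (h : Sym k) (t : Fin 3 → Pt n) :
    orbitSum κ (act h t) = orbitSum κ t := by
  unfold orbitSum
  have hmul : ∀ g : Sym k, act g (act h t) = act (h * g) t := by
    intro g; funext i e; simp [act, Equiv.Perm.mul_apply]
  simp_rw [hmul]
  exact Fintype.sum_equiv (Equiv.mulLeft h) _ _ (fun g => rfl)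

/-- Every triple has a sorted element in its orbit (each block weakly increasing along the slots). [this work] -/
theorem exists_sorted (t : Fin 3 → Pt n) : ∃ h : Sym 3, ∀ e, Monotone (fun i => act h t i e) :=
  ⟨fun e => Tuple.sort (fun i => t i e), fun e => Tuple.monotone_sort (fun i => t i e)⟩

/-- The comparison pattern of a sorted triple: tie bits `(t 0 e = t 1 e, t 1 e = t 2 e)` per block. [this work] -/
def patPre (b : Fin 3 → Bool × Bool) (e : Fin 3) (i i' : Fin 3) : Bool :=
  decide (i.val ≤ i'.val) || (decide (i.val = 1 ∧ i'.val = 0) && (b e).1) || (decide (i.val = 2 ∧ i'.val = 1) && (b e).2) ||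
    (decide (i.val = 2 ∧ i'.val = 0) && (b e).1 && (b e).2)

/-- The tie bits of a triple. [this work] -/
def tieBits (t : Fin 3 → Pt n) (e : Fin 3) : Bool × Bool := (decide (t 0 e = t 1 e), decide (t 1 e = t 2 e))

/-- Comparisons inside a sorted triple of naturals, by cases on the slots. [this work] -/
theorem sorted_le_iff (v : Fin 3 → ℕ) (h1 : v 0 ≤ v 1) (h2 : v 1 ≤ v 2) (i i' : Fin 3) :
    (v i ≤ v i') ↔ (i.val ≤ i'.val ∨ (i.val = 1 ∧ i'.val = 0 ∧ v 0 = v 1) ∨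
      (i.val = 2 ∧ i'.val = 1 ∧ v 1 = v 2) ∨ (i.val = 2 ∧ i'.val = 0 ∧ v 0 = v 1 ∧ v 1 = v 2)) := by
  fin_cases i <;> fin_cases i' <;> simp <;> omega

/-- For a sorted triple the comparison data is the pattern of its tie bits. [this work] -/
theorem preOf_eq_patPre (t : Fin 3 → Pt n) (hsort : ∀ e, Monotone (fun i => t i e)) : preOf t = patPre (tieBits t) := by
  funext e i i'
  have h01 : (t 0 e : ℕ) ≤ t 1 e := hsort e (show (0 : Fin 3) ≤ 1 by decide)
  have h12 : (t 1 e : ℕ) ≤ t 2 e := hsort e (show (1 : Fin 3) ≤ 2 by decide)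
  have key := sorted_le_iff (fun i => (t i e : ℕ)) h01 h12 i i'
  rw [Bool.eq_iff_iff]
  simp only [preOf, patPre, tieBits, Bool.or_eq_true, Bool.and_eq_true, decide_eq_true_eq, Fin.le_iff_val_le_val,
    Fin.ext_iff]
  simpa [and_assoc, or_assoc] using key

/-- **Reduction to the 64 sorted comparison patterns.** [this work] -/
theorem threeBlockMedianCertificate_of_patterns
    (h : ∀ (b : Fin 3 → Bool × Bool) (D : LocalDatum), D.Valid (patPre b) → 0 ≤ D.FlocT) :
    ThreeBlockMedianCertificate := by
  apply threeBlockMedianCertificate_of_poleT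
  intro n lab hlab t
  obtain ⟨hh, hsort⟩ := exists_sorted t
  have h6 := orbitSum_kerSym 1 0 lab (mT lab) (act hh t)
  have hF := orbitSum_kerSym_eq_FlocT lab (act hh t)
  have hv := h (tieBits (act hh t)) (datum lab (act hh t))
    (preOf_eq_patPre (act hh t) hsort ▸ datum_valid hlab (act hh t))
  rw [← hF, h6, orbitSum_act] at hv
  have : orbitSum (fun s => ker 1 0 lab (mT lab) (s 0) (s 1) (s 2)) t =
      orbitSum (fun t => ker 1 0 lab (mT lab) (t 0) (t 1) (t 2)) t := rfl
  linarith

/-! ### B. Positions: index vectors as `Fin 27` -/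

/-- Decode a position `0..26` into an index vector (block `e` digit in base 3). [this work] -/
def dec (k : Fin 27) : J := fun e => ⟨(k.val / 3 ^ e.val) % 3, Nat.mod_lt _ (by decide)⟩

/-- Encode an index vector as a position. [this work] -/
def enc (j : J) : Fin 27 := ⟨(j 0).val + 3 * (j 1).val + 9 * (j 2).val, by omega⟩

/-- `dec` is a left inverse of `enc`. [this work] -/
theorem dec_enc (j : J) : dec (enc j) = j := by
  revert j; decide

/-- `enc` is a left inverse of `dec`. [this work] -/
theorem enc_dec (k : Fin 27) : enc (dec k) = k := by
  revert k; decide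

/-! ### C. Generic sequential enumeration with prefix-dependent choices -/

/-- All lists of length `N` built left to right, the `k`-th entry drawn from `choices (prefix)`. [this work] -/
def enumSeq {α : Type} (choices : List α → List α) : ℕ → List (List α)
  | 0 => [[]]
  | N + 1 => (enumSeq choices N).flatMap fun l => (choices l).map fun a => l ++ [a]

/-- COMPLETENESS of `enumSeq`: a list all of whose entries are admissible given their prefix is enumerated. [this work] -/
theorem mem_enumSeq {α : Type} (choices : List α → List α) :
    ∀ (N : ℕ) (l : List α), l.length = N → (∀ (k : ℕ) (hk : k < l.length), l[k] ∈ choices (l.take k)) →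
      l ∈ enumSeq choices N := by
  intro N
  induction N with
  | zero =>
    intro l hl _
    rw [List.length_eq_zero_iff] at hl
    subst hl; simp [enumSeq]
  | succ N ih =>
    intro l hl h
    -- split off the last entry
    obtain ⟨l', a, rfl⟩ : ∃ l' a, l = l' ++ [a] := by
      cases l using List.reverseRecOn with
      | nil => simp at hl
      | append_singleton l' a => exact ⟨l', a, rfl⟩
    simp only [List.length_append, List.length_singleton, Nat.add_right_cancel_iff] at hl
    have hl' : l' ∈ enumSeq choices N := by
      refine ih l' hl fun k hk => ?_
      have := h k (by simp; omega)
      rwa [List.getElem_append_left hk, List.take_append_of_le_length (le_of_lt hk)] at this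
    have ha : a ∈ choices l' := by
      have := h l'.length (by simp)
      simpa using this
    simp only [enumSeq, List.mem_flatMap, List.mem_map]
    exact ⟨l', hl', a, ha, rfl⟩


/-- Depth-first check of `test` on every list of length `|pre| + N` extending `pre` admissibly (no list of lists is
materialised). [this work] -/
def allSeq {α : Type} (choices : List α → List α) (test : List α → Bool) : ℕ → List α → Bool
  | 0, pre => test pre
  | N + 1, pre => (choices pre).all fun a => allSeq choices test N (pre ++ [a])

/-- SOUNDNESS/COMPLETENESS of `allSeq`: if the check passes, `test` holds on every admissible extension. [this work] -/
theorem allSeq_spec {α : Type} (choices : List α → List α) (test : List α → Bool) :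
    ∀ (N : ℕ) (pre l : List α), l.length = N → (∀ (k : ℕ) (hk : k < l.length), l[k] ∈ choices (pre ++ l.take k)) →
      allSeq choices test N pre = true → test (pre ++ l) = true := by
  intro N
  induction N with
  | zero =>
    intro pre l hl _ h
    rw [List.length_eq_zero_iff] at hl
    subst hl; simpa [allSeq] using h
  | succ N ih =>
    intro pre l hl hch h
    obtain ⟨a, l', rfl⟩ : ∃ a l', l = a :: l' := by
      cases l with
      | nil => simp at hl
      | cons a l' => exact ⟨a, l', rfl⟩
    simp only [List.length_cons, Nat.add_right_cancel_iff] at hl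
    simp only [allSeq, List.all_eq_true] at h
    have ha : a ∈ choices pre := by
      have := hch 0 (by simp)
      simpa using this
    have h' := h a ha
    have := ih (pre ++ [a]) l' hl (fun k hk => by
      have := hch (k + 1) (by simp; omega)
      simpa [List.take_succ_cons, List.append_assoc] using this) h'
    simpa [List.append_assoc] using this

/-! ### D. The checker: cells, representatives, candidates, forced pairs, the lower bound `Xloc` -/

/-- Decode a natural position (base-3 digits) into an index vector. [this work] -/
def decN (k : ℕ) : J := fun e => ⟨(k / 3 ^ e.val) % 3, Nat.mod_lt _ (by decide)⟩

/-- Encode an index vector as a natural position. [this work] -/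
def encN (j : J) : ℕ := (j 0).val + 3 * (j 1).val + 9 * (j 2).val

/-- `decN ∘ encN = id`. [this work] -/
theorem decN_encN (j : J) : decN (encN j) = j := by
  revert j; decide

/-- `encN` is below `27`. [this work] -/
theorem encN_lt (j : J) : encN j < 27 := by
  unfold encN; omega

/-- Blockwise comparison of index vectors under a pattern (explicit conjunction, for speed). [this work] -/
def leJ (b : Fin 3 → Bool × Bool) (j j' : J) : Bool :=
  patPre b 0 (j 0) (j' 0) && patPre b 1 (j 1) (j' 1) && patPre b 2 (j 2) (j' 2)

/-- `leJ` is the blockwise comparison. [this work] -/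
theorem leJ_eq_true_iff (b : Fin 3 → Bool × Bool) (j j' : J) : leJ b j j' = true ↔ ∀ e, patPre b e (j e) (j' e) = true := by
  simp only [leJ, Bool.and_eq_true]
  constructor
  · rintro ⟨⟨h0, h1⟩, h2⟩ e; fin_cases e <;> assumption
  · intro h; exact ⟨⟨h 0, h 1⟩, h 2⟩

/-- Same point under a pattern (comparable both ways). [this work] -/
def eqvJ (b : Fin 3 → Bool × Bool) (j j' : J) : Bool := leJ b j j' && leJ b j' j

/-- The six permutations of the three slots, as functions. [this work] -/
def permList : List (Equiv.Perm (Fin 3)) :=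
  [1, Equiv.swap 0 1, Equiv.swap 0 2, Equiv.swap 1 2, Equiv.swap 0 1 * Equiv.swap 1 2, Equiv.swap 1 2 * Equiv.swap 0 1]

/-- The slot index vector of slot `i` for the block permutations `σ₀, σ₁, σ₂`. [this work] -/
def mkSlot (σ₀ σ₁ σ₂ : Equiv.Perm (Fin 3)) (i : Fin 3) : J := fun e => (![σ₀, σ₁, σ₂] e) i

/-- Sum of a function of the three slot index vectors over all `6³` block permutations (explicit list form of `Σ_{g ∈ S₃³}`). [this work] -/
def slotSum (F : J → J → J → ℤ) : ℤ :=
  (permList.map fun σ₀ => (permList.map fun σ₁ => (permList.map fun σ₂ =>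
    F (mkSlot σ₀ σ₁ σ₂ 0) (mkSlot σ₀ σ₁ σ₂ 1) (mkSlot σ₀ σ₁ σ₂ 2)).sum).sum).sum

/-- Sums over `Perm (Fin 3)` are six-term list sums. [this work] -/
theorem sum_perm3 (h : Equiv.Perm (Fin 3) → ℤ) : ∑ σ : Equiv.Perm (Fin 3), h σ = (permList.map h).sum := by
  have hnd : permList.Nodup := by decide
  have huniv : (Finset.univ : Finset (Equiv.Perm (Fin 3))) = permList.toFinset := by decide
  rw [huniv, List.sum_toFinset _ hnd]

/-- **`Σ_{g ∈ S₃³}` over slot index vectors is `slotSum`.** [this work] -/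
theorem sum_sym3_eq_slotSum (F : J → J → J → ℤ) :
    ∑ g : Sym 3, F (gidx g 0) (gidx g 1) (gidx g 2) = slotSum F := by
  rw [Fintype.sum_equiv (tripleEquiv (Equiv.Perm (Fin 3))) _
    (fun p => F (mkSlot p.1 p.2.1 p.2.2 0) (mkSlot p.1 p.2.1 p.2.2 1) (mkSlot p.1 p.2.1 p.2.2 2))
    (by
      intro g
      have : ∀ i, gidx g i = mkSlot (g 0) (g 1) (g 2) i := by
        intro i; funext e; fin_cases e <;> rfl
      simp only [this]; rfl)]
  rw [Fintype.sum_prod_type, slotSum, sum_perm3]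
  congr 1; refine List.map_congr_left fun σ₀ _ => ?_
  rw [Fintype.sum_prod_type, sum_perm3]
  congr 1; refine List.map_congr_left fun σ₁ _ => ?_
  rw [sum_perm3]

/-- Sum of a `flatMap` (helper). [this work] -/
theorem sum_flatMap_int {α : Type} (l : List α) (g : α → List ℤ) : (l.flatMap g).sum = (l.map fun a => (g a).sum).sum := by
  induction l with
  | nil => simp
  | cons a l ih => simp [List.flatMap_cons, List.sum_append, ih]

/-! #### Per-pattern tables (computed once per comparison pattern) -/

/-- Comparability table of positions: entry `k' * 27 + k` is `leJ b (decN k') (decN k)`. [this work] -/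
def leTab (b : Fin 3 → Bool × Bool) : Array Bool := Array.ofFn (n := 729) fun i => leJ b (decN (i.val / 27)) (decN (i.val % 27))

/-- Table lookup of comparability. [this work] -/
def leT (lt : Array Bool) (k' k : ℕ) : Bool := lt.getD (k' * 27 + k) false

/-- Canonical position of a position: the least position denoting the same point under the pattern. [this work] -/
def canonTab (b : Fin 3 → Bool × Bool) : Array ℕ :=
  Array.ofFn (n := 27) fun k => ((List.range 27).find? fun k' => eqvJ b (decN k') (decN k.val)).getD k.val

/-- Median/maximum table: entry `(k₁*27 + k₂)*27 + k₃` holds the canonical positions of the blockwise median and maximum of the three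
index vectors. [this work] -/
def medTab (b : Fin 3 → Bool × Bool) (ct : Array ℕ) : Array (ℕ × ℕ) :=
  Array.ofFn (n := 19683) fun i =>
    let k₁ := i.val / 729; let k₂ := (i.val / 27) % 27; let k₃ := i.val % 27
    (ct.getD (encN (medIdx (patPre b) (decN k₁) (decN k₂) (decN k₃))) 0,
     ct.getD (encN (joinIdx (patPre b) (decN k₁) (decN k₂) (decN k₃))) 0)

/-! #### Slot records (computed once) -/

/-- A slot record: the three slot index vectors of a block-permutation triple together with the positions of the points the kernel
looks at (the slots, the one-block lifts `update x e (y e)`, the two-block lifts `update y e (x e)`). [this work] -/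
structure SlotRec where
  /-- slot index vectors -/
  x : J
  /-- slot index vectors -/
  y : J
  /-- slot index vectors -/
  z : J
  /-- positions of the slots -/
  px : ℕ
  /-- positions of the slots -/
  py : ℕ
  /-- positions of the slots -/
  pz : ℕ
  /-- positions of the one-block lifts -/
  pu0 : ℕ
  /-- positions of the one-block lifts -/
  pu1 : ℕ
  /-- positions of the one-block lifts -/
  pu2 : ℕ
  /-- positions of the two-block lifts -/
  pv0 : ℕ
  /-- positions of the two-block lifts -/
  pv1 : ℕ
  /-- positions of the two-block lifts -/
  pv2 : ℕ
  /-- slot indices of `x` and `y` per block (for the strictness test) -/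
  xs0 : Fin 3
  /-- slot indices of `x` and `y` per block (for the strictness test) -/
  xs1 : Fin 3
  /-- slot indices of `x` and `y` per block (for the strictness test) -/
  xs2 : Fin 3
  /-- slot indices of `x` and `y` per block (for the strictness test) -/
  ys0 : Fin 3
  /-- slot indices of `x` and `y` per block (for the strictness test) -/
  ys1 : Fin 3
  /-- slot indices of `x` and `y` per block (for the strictness test) -/
  ys2 : Fin 3

/-- The slot record of three index vectors. [this work] -/
def mkRec (x y z : J) : SlotRec where
  x := x
  y := y
  z := z
  px := encN x
  py := encN y
  pz := encN z
  pu0 := encN (Function.update x 0 (y 0))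
  pu1 := encN (Function.update x 1 (y 1))
  pu2 := encN (Function.update x 2 (y 2))
  pv0 := encN (Function.update y 0 (x 0))
  pv1 := encN (Function.update y 1 (x 1))
  pv2 := encN (Function.update y 2 (x 2))
  xs0 := x 0
  xs1 := x 1
  xs2 := x 2
  ys0 := y 0
  ys1 := y 1
  ys2 := y 2

/-- The `216` slot triples `(g·0, g·1, g·2)`, `g ∈ S₃³`, as index vectors. [this work] -/
def slotTriples : List (J × J × J) :=
  permList.flatMap fun σ₀ => permList.flatMap fun σ₁ => permList.map fun σ₂ =>
    (mkSlot σ₀ σ₁ σ₂ 0, mkSlot σ₀ σ₁ σ₂ 1, mkSlot σ₀ σ₁ σ₂ 2)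

/-- The `216` slot records. [this work] -/
def slotRecs : List SlotRec := slotTriples.map fun t => mkRec t.1 t.2.1 t.2.2

/-- `slotSum` as a sum over `slotTriples`. [this work] -/
theorem slotSum_eq (F : J → J → J → ℤ) : slotSum F = (slotTriples.map fun t => F t.1 t.2.1 t.2.2).sum := by
  simp only [slotSum, slotTriples, List.map_flatMap, List.map_map, sum_flatMap_int]
  rfl

/-! #### The enumerators -/

/-- Array lookups of a converted list are list lookups (helper). [this work] -/
theorem list_toArray_getD {α : Type} (l : List α) (k : ℕ) (d : α) : l.toArray.getD k d = l.getD k d := by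
  rw [Array.getD_eq_getD_getElem?, List.getD_eq_getElem?_getD, List.getElem?_toArray]

/-- Admissible cell codes (`0` bottom, `1` petal, `2` kernel) for the next position, given the prefix: monotone with respect to every
earlier comparable position (the lists `ba.1 k` / `ba.2 k` of earlier positions below / above position `k`). [this work] -/
def choicesCell (ba : Array (List ℕ) × Array (List ℕ)) (l : List (Fin 3)) : List (Fin 3) :=
  let la := l.toArray
  let k := la.size
  [0, 1, 2].filter fun v =>
    ((ba.1.getD k []).all fun k' => decide (la.getD k' 1 ≤ v)) && ((ba.2.getD k []).all fun k' => decide (v ≤ la.getD k' 1))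

/-- The earlier positions below / above each position (computed once per pattern; used by `choicesCell`). [this work] -/
def cmpTabs (lt : Array Bool) : Array (List ℕ) × Array (List ℕ) :=
  (Array.ofFn (n := 27) fun k => (List.range k.val).filter fun k' => leT lt k' k.val,
   Array.ofFn (n := 27) fun k => (List.range k.val).filter fun k' => leT lt k.val k')

/-- Entries of the comparison-position tables. [this work] -/
theorem cmpTabs_getD (lt : Array Bool) {k : ℕ} (hk : k < 27) :
    (cmpTabs lt).1.getD k [] = (List.range k).filter (fun k' => leT lt k' k) ∧
      (cmpTabs lt).2.getD k [] = (List.range k).filter (fun k' => leT lt k k') := by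
  constructor <;> (rw [cmpTabs, Array.getD_eq_getD_getElem?, Array.getElem?_ofFn]; simp [hk])

/-- Earlier comparable petal positions of each position (computed once per cell configuration). [this work] -/
def compPet (lt : Array Bool) (c : Array (Fin 3)) : Array (List ℕ) :=
  Array.ofFn (n := 27) fun k => if c.getD k.val 1 = 1 then
    (List.range k.val).filter fun k' => c.getD k' 1 = 1 ∧ (leT lt k' k.val || leT lt k.val k') else []

/-- Entries of `compPet` at petal positions. [this work] -/
theorem compPet_getD (lt : Array Bool) (c : Array (Fin 3)) {k : ℕ} (hk : k < 27) (hc : c.getD k 1 = 1) :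
    (compPet lt c).getD k [] = (List.range k).filter fun k' => c.getD k' 1 = 1 ∧ (leT lt k' k || leT lt k k') := by
  rw [compPet, Array.getD_eq_getD_getElem?, Array.getElem?_ofFn]
  simp [hk, hc]

/-- Admissible representatives for the next position, given the cells and the prefix: a non-petal position represents itself; a petal
position with an earlier comparable petal position takes its representative, otherwise it points to itself or to an earlier petal root;
in all cases it must agree with every earlier comparable petal position. [this work] -/
def choicesRep (cp : Array (List ℕ)) (c : Array (Fin 3)) (l : List ℕ) : List ℕ :=
  let la := l.toArray
  let k := la.size
  if c.getD k 1 ≠ 1 then [k] else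
    let cands := match cp.getD k [] with
      | k' :: _ => [la.getD k' 0]
      | [] => k :: (List.range k).filter fun k' => c.getD k' 1 = 1 ∧ la.getD k' 0 = k'
    cands.filter fun v => (cp.getD k []).all fun k' => decide (la.getD k' 0 = v)


end FiniteCheck

end ChainCert

end Summit.CriticalPhenomena.PercolationContinuityZ3.Theorems.SunflowerPartition
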